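import Mathlib
import Literature.MathematicalPhysics.QuantumLattice.Imbrie2016.DyadicHomogeneity

/-!
# Localisation: pointwise local linear laws on a compact set give a linear law near the set

Supporting measure theory for the level-statistics (assumption LLA(ν, C₀), eq. (1.5)) analysis of
the three-spin block of
[cite: ImbrieJSP2016, eq. (1.1), assumption LLA(ν, C)]  Repair cell b2b-imbrie, LLA.md block Q7,
step (Q7.2) LOCALISATION, in abstract form.
J. Z. Imbrie, *On many-body localization for quantum spin chains*,
J. Stat. Phys. 163 (2016) 998–1048, arXiv:1403.7837 (Theorem 1.1, Assumption LLA).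

`local_to_compact`: if every point `x` of a compact set `K` has a neighbourhood `U` and a finite
constant `C` with `μ (A ε ∩ U) ≤ C ε` for all `ε > 0` (a LOCAL LINEAR LAW for the family of sets
`A ε`, think `A ε = {p : gap (H p) < ε}`), then there are a set `U ⊇ K` and one finite `C` with
`μ (A ε ∩ U) ≤ C ε` (finite subcover, finite sum).  `shell_law_of_local_laws` specialises to the
compact annulus `{1/2 ≤ ‖x‖ ≤ 1}` of a finite-dimensional real normed space and yields the linear
law on the dyadic shell `{1/2 < ‖x‖ ≤ 1}` — the hypothesis of the dyadic homogeneity lemma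
(companion file `DyadicHomogeneity`); `ball_law_of_local_laws` combines the two: pointwise local
linear laws on the annulus plus the scaling rule `c • A ε = A (c ε)` give ONE linear law, with a
finite constant, on the punctured unit ball (dimension `≥ 2`).  This is the kernel-checked form of
'(L_box) ⟸ local linear laws at the points of the unit sphere' (LLA.md (Q7.1) + (Q7.2)), modulo the
identification of the gap sets of a degree-one homogeneous matrix family with such an `A`.

The last section makes that identification formal in a variational guise: for a family
`ω ↦ H ω` of linear operators on a real normed space `V`, positively homogeneous of degree one
(`H (c • ω) = c • H ω`, `c > 0` — e.g. a LINEAR family such as the three-spin block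
`ω = (h, J, t) ↦ Σ hᵢZᵢ + Σ JᵢZᵢZᵢ₊₁ + Σ tᵢXᵢ`), the VARIATIONAL SMALL-GAP SET
`smallGap H ε = {ω | ∃ λ, ∃ W ⊆ V two-dimensional, ∀ v ∈ W, ‖H ω v − λ v‖ ≤ ε ‖v‖}` satisfies the
scaling rule exactly (`smallGap_scaling`), and so does its restriction to a polyhedral cone
`{ω | ∀ i, 0 ≤ fᵢ ω}` (the constraint `t ≥ 0` of the model); `ball_law_smallGap` is then the
globalisation for these sets.  DICTIONARY (not formalised, by min–max applied to `(H ω − λ)²`): for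
`H ω` symmetric on an inner-product space, `ω ∈ smallGap H ε` iff `H ω` has two eigenvalues, counted
with multiplicity, at distance `≤ 2ε`, i.e. iff the minimal adjacent gap of `H ω` is `≤ 2ε`; so linear
laws for `smallGap` and for `{min gap < ε}` are equivalent up to the constant.

No spectral theory is formalised here.
-/

namespace Literature.MathematicalPhysics.QuantumLattice.Imbrie2016.LocalLawCompactness

open MeasureTheory Set Filter
open scoped ENNReal Topology Pointwise

/-- [cite: ImbrieJSP2016, eq. (1.1), assumption LLA(ν, C)] LOCALISATION.  Pointwise local linear
laws at the points of a compact set `K` give one linear law on a set `U ⊇ K` (union of finitely many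
of the local neighbourhoods), with the sum of the finitely many local constants. -/
theorem local_to_compact {X : Type*} [TopologicalSpace X] [MeasurableSpace X] (μ : Measure X)
    {K : Set X} (hK : IsCompact K) (A : ℝ → Set X)
    (hloc : ∀ x ∈ K, ∃ U ∈ 𝓝 x, ∃ C : ℝ≥0∞, C ≠ ⊤ ∧
      ∀ ε : ℝ, 0 < ε → μ (A ε ∩ U) ≤ C * ENNReal.ofReal ε) :
    ∃ U : Set X, K ⊆ U ∧ ∃ C : ℝ≥0∞, C ≠ ⊤ ∧
      ∀ ε : ℝ, 0 < ε → μ (A ε ∩ U) ≤ C * ENNReal.ofReal ε := by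
  classical
  choose! U hU C hC hlaw using hloc
  obtain ⟨t, htK, hcover⟩ := hK.elim_nhds_subcover U (fun x hx => hU x hx)
  refine ⟨⋃ x ∈ t, U x, hcover, ∑ x ∈ t, C x, ?_, ?_⟩
  · exact ENNReal.sum_ne_top.mpr (fun x hx => hC x (htK x hx))
  · intro ε hε
    calc μ (A ε ∩ ⋃ x ∈ t, U x) = μ (⋃ x ∈ t, (A ε ∩ U x)) := by rw [inter_iUnion₂]
      _ ≤ ∑ x ∈ t, μ (A ε ∩ U x) := measure_biUnion_finset_le t _
      _ ≤ ∑ x ∈ t, C x * ENNReal.ofReal ε :=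
          Finset.sum_le_sum (fun x hx => hlaw x (htK x hx) ε hε)
      _ = (∑ x ∈ t, C x) * ENNReal.ofReal ε := by rw [Finset.sum_mul]

variable {E : Type*} [NormedAddCommGroup E] [NormedSpace ℝ E] [FiniteDimensional ℝ E]
  [MeasurableSpace E]

omit [MeasurableSpace E] in
/-- [cite: ImbrieJSP2016, eq. (1.1)] The closed annulus `{1/2 ≤ ‖x‖ ≤ 1}` of a finite-dimensional
real normed space is compact. -/
theorem isCompact_annulus :
    IsCompact {x : E | (1/2 : ℝ) ≤ ‖x‖ ∧ ‖x‖ ≤ 1} := by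
  have hsub : {x : E | (1/2 : ℝ) ≤ ‖x‖ ∧ ‖x‖ ≤ 1} ⊆ Metric.closedBall (0 : E) 1 := by
    intro x hx; simpa [Metric.mem_closedBall, dist_zero_right] using hx.2
  have hclosed : IsClosed {x : E | (1/2 : ℝ) ≤ ‖x‖ ∧ ‖x‖ ≤ 1} := by
    rw [setOf_and]
    exact (isClosed_le continuous_const continuous_norm).inter
      (isClosed_le continuous_norm continuous_const)
  exact (isCompact_closedBall (0 : E) 1).of_isClosed_subset hclosed hsub

/-- [cite: ImbrieJSP2016, eq. (1.1), assumption LLA(ν, C)] Local linear laws at every point of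
the closed annulus `{1/2 ≤ ‖x‖ ≤ 1}` give a linear law on the dyadic shell `{1/2 < ‖x‖ ≤ 1}`
(the hypothesis `hshell` of the dyadic homogeneity lemma). -/
theorem shell_law_of_local_laws (μ : Measure E) (A : ℝ → Set E)
    (hloc : ∀ x : E, (1/2 : ℝ) ≤ ‖x‖ → ‖x‖ ≤ 1 → ∃ U ∈ 𝓝 x, ∃ C : ℝ≥0∞, C ≠ ⊤ ∧
      ∀ ε : ℝ, 0 < ε → μ (A ε ∩ U) ≤ C * ENNReal.ofReal ε) :
    ∃ C : ℝ≥0∞, C ≠ ⊤ ∧ ∀ ε : ℝ, 0 < ε →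
      μ (A ε ∩ {x : E | (1/2 : ℝ) < ‖x‖ ∧ ‖x‖ ≤ 1}) ≤ C * ENNReal.ofReal ε := by
  obtain ⟨U, hKU, C, hC, hlaw⟩ := local_to_compact μ (isCompact_annulus (E := E)) A
    (fun x hx => hloc x hx.1 hx.2)
  refine ⟨C, hC, fun ε hε => le_trans (measure_mono ?_) (hlaw ε hε)⟩
  intro x hx
  exact ⟨hx.1, hKU ⟨hx.2.1.le, hx.2.2⟩⟩

/-- [cite: ImbrieJSP2016, eq. (1.1), assumption LLA(ν, C)] GLOBALISATION.  In dimension `≥ 2`: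
pointwise local linear laws at the points of the closed annulus `{1/2 ≤ ‖x‖ ≤ 1}` together with the
scaling rule `c • A ε = A (c ε)` (`c > 0`) give a linear law with a FINITE constant on the punctured
unit ball `{0 < ‖x‖ ≤ 1}`. -/
theorem ball_law_of_local_laws [BorelSpace E] [Nontrivial E] (μ : Measure E) [μ.IsAddHaarMeasure]
    (hd : 2 ≤ Module.finrank ℝ E) (A : ℝ → Set E)
    (hscale : ∀ c ε : ℝ, 0 < c → c • A ε = A (c * ε))
    (hloc : ∀ x : E, (1/2 : ℝ) ≤ ‖x‖ → ‖x‖ ≤ 1 → ∃ U ∈ 𝓝 x, ∃ C : ℝ≥0∞, C ≠ ⊤ ∧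
      ∀ ε : ℝ, 0 < ε → μ (A ε ∩ U) ≤ C * ENNReal.ofReal ε) :
    ∃ C' : ℝ≥0∞, C' ≠ ⊤ ∧ ∀ ε : ℝ, 0 < ε →
      μ (A ε ∩ {x : E | 0 < ‖x‖ ∧ ‖x‖ ≤ 1}) ≤ C' * ENNReal.ofReal ε := by
  obtain ⟨C, hC, hshell⟩ := shell_law_of_local_laws μ A hloc
  have hshell' : ∀ ε : ℝ, 0 < ε → μ (A ε ∩ DyadicHomogeneity.shell 0) ≤ C * ENNReal.ofReal ε := by
    intro ε hε
    have hS : (DyadicHomogeneity.shell 0 : Set E) = {x : E | (1/2 : ℝ) < ‖x‖ ∧ ‖x‖ ≤ 1} := by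
      ext x; simp [DyadicHomogeneity.shell]
    rw [hS]; exact hshell ε hε
  set ρ : ℝ≥0∞ := ENNReal.ofReal ((1/2 : ℝ) ^ (Module.finrank ℝ E - 1)) with hρ
  refine ⟨C * (1 - ρ)⁻¹, ?_, ?_⟩
  · have hρ1 : ρ < 1 := by
      rw [hρ, ENNReal.ofReal_lt_one]
      exact pow_lt_one₀ (by norm_num) (by norm_num) (by omega)
    have hne : 1 - ρ ≠ 0 := (tsub_pos_iff_lt.mpr hρ1).ne'
    exact ENNReal.mul_ne_top hC (ENNReal.inv_ne_top.mpr hne)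
  · intro ε hε
    exact DyadicHomogeneity.dyadic_homogeneity μ A C hscale hshell' ε hε

/-- [cite: ImbrieJSP2016, eq. (1.1), assumption LLA(ν, C)] TRANSPORT OF A LOCAL LAW BY SCALING.
Under the scaling rule, a linear law on `U` gives a linear law on the dilate `c • U` (`c > 0`) with
constant multiplied by `c ^ (d - 1)`, `d = finrank ℝ E ≥ 1`. -/
theorem local_law_smul [BorelSpace E] [Nontrivial E] (μ : Measure E) [μ.IsAddHaarMeasure]
    (A : ℝ → Set E) (hscale : ∀ c ε : ℝ, 0 < c → c • A ε = A (c * ε))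
    {U : Set E} {C : ℝ≥0∞} (hlaw : ∀ ε : ℝ, 0 < ε → μ (A ε ∩ U) ≤ C * ENNReal.ofReal ε)
    {c : ℝ} (hc : 0 < c) :
    ∀ ε : ℝ, 0 < ε →
      μ (A ε ∩ c • U) ≤ ENNReal.ofReal (c ^ (Module.finrank ℝ E - 1)) * C * ENNReal.ofReal ε := by
  intro ε hε
  set d := Module.finrank ℝ E with hd
  have hd1 : 1 ≤ d := Module.finrank_pos
  have hAc : A ε = c • A (ε / c) := by
    rw [hscale c (ε / c) hc]; congr 1; field_simp
  have hset : A ε ∩ c • U = c • (A (ε / c) ∩ U) := by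
    rw [smul_set_inter₀ hc.ne', ← hAc]
  rw [hset, Measure.addHaar_smul_of_nonneg μ hc.le]
  have hl := hlaw (ε / c) (div_pos hε hc)
  calc ENNReal.ofReal (c ^ d) * μ (A (ε / c) ∩ U)
      ≤ ENNReal.ofReal (c ^ d) * (C * ENNReal.ofReal (ε / c)) := by gcongr
    _ = C * (ENNReal.ofReal (c ^ d) * ENNReal.ofReal (ε / c)) := by ring
    _ = C * ENNReal.ofReal (c ^ d * (ε / c)) := by
        rw [ENNReal.ofReal_mul (by positivity)]
    _ = C * ENNReal.ofReal (ε * c ^ (d - 1)) := by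
        congr 2
        obtain ⟨m, hm⟩ : ∃ m, d = m + 1 := ⟨d - 1, by omega⟩
        rw [hm, Nat.add_sub_cancel, pow_succ]; field_simp
    _ = ENNReal.ofReal (c ^ (d - 1)) * C * ENNReal.ofReal ε := by
        rw [ENNReal.ofReal_mul hε.le]; ring

/-- [cite: ImbrieJSP2016, eq. (1.1), assumption LLA(ν, C)] GLOBALISATION FROM THE SPHERE
(the form used in LLA.md (Q7.2)).  In dimension `≥ 2`: if every point of the unit sphere has a
neighbourhood carrying a local linear law for the sets `A ε`, and the scaling rule holds, then
there is ONE linear law with a finite constant on the punctured unit ball. -/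
theorem ball_law_of_sphere_laws [BorelSpace E] [Nontrivial E] (μ : Measure E) [μ.IsAddHaarMeasure]
    (hd : 2 ≤ Module.finrank ℝ E) (A : ℝ → Set E)
    (hscale : ∀ c ε : ℝ, 0 < c → c • A ε = A (c * ε))
    (hsph : ∀ y : E, ‖y‖ = 1 → ∃ U ∈ 𝓝 y, ∃ C : ℝ≥0∞, C ≠ ⊤ ∧
      ∀ ε : ℝ, 0 < ε → μ (A ε ∩ U) ≤ C * ENNReal.ofReal ε) :
    ∃ C' : ℝ≥0∞, C' ≠ ⊤ ∧ ∀ ε : ℝ, 0 < ε →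
      μ (A ε ∩ {x : E | 0 < ‖x‖ ∧ ‖x‖ ≤ 1}) ≤ C' * ENNReal.ofReal ε := by
  apply ball_law_of_local_laws μ hd A hscale
  intro x hx1 hx2
  have hxpos : 0 < ‖x‖ := lt_of_lt_of_le (by norm_num) hx1
  have hx0 : x ≠ 0 := norm_pos_iff.mp hxpos
  set c : ℝ := ‖x‖ with hc_def
  set y : E := c⁻¹ • x with hy_def
  have hy : ‖y‖ = 1 := by
    rw [hy_def, norm_smul, norm_inv, norm_norm, inv_mul_cancel₀ hxpos.ne']
  obtain ⟨U, hU, C, hC, hlaw⟩ := hsph y hy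
  have hxy : x = c • y := by
    rw [hy_def, smul_smul, mul_inv_cancel₀ hxpos.ne', one_smul]
  refine ⟨c • U, ?_, ENNReal.ofReal (c ^ (Module.finrank ℝ E - 1)) * C, ?_, ?_⟩
  · rw [hxy]; exact (smul_mem_nhds_smul_iff₀ hxpos.ne').mpr hU
  · exact ENNReal.mul_ne_top ENNReal.ofReal_ne_top hC
  · exact local_law_smul μ A hscale hlaw hxpos

/-! ## The variational small-gap set of a positively homogeneous operator family -/

section SmallGap

variable {V : Type*} [NormedAddCommGroup V] [NormedSpace ℝ V]

omit [FiniteDimensional ℝ E] [MeasurableSpace E] in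
/-- [cite: ImbrieJSP2016, eq. (1.1), assumption LLA(ν, C)] The VARIATIONAL SMALL-GAP SET of an
operator family `H : E → V →ₗ[ℝ] V` at resolution `ε`: the parameters `ω` at which some
two-dimensional subspace is an `ε`-approximate eigenspace of `H ω` for one approximate eigenvalue
`λ` (for symmetric `H ω`: two eigenvalues within `2ε`). -/
def smallGap (H : E → V →ₗ[ℝ] V) (ε : ℝ) : Set E :=
  {ω | ∃ l : ℝ, ∃ W : Submodule ℝ V, Module.finrank ℝ W = 2 ∧
    ∀ v ∈ W, ‖H ω v - l • v‖ ≤ ε * ‖v‖}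

omit [FiniteDimensional ℝ E] [MeasurableSpace E] in
/-- [cite: ImbrieJSP2016, eq. (1.1)] Positive homogeneity of degree one transports the small-gap
set: `ω ∈ smallGap H ε → c • ω ∈ smallGap H (c ε)` for `c > 0`. -/
theorem smul_mem_smallGap {H : E → V →ₗ[ℝ] V}
    (hH : ∀ c : ℝ, 0 < c → ∀ ω : E, H (c • ω) = c • H ω) {c : ℝ} (hc : 0 < c) {ε : ℝ} {ω : E}
    (hω : ω ∈ smallGap H ε) : c • ω ∈ smallGap H (c * ε) := by
  obtain ⟨l, W, hW, hv⟩ := hω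
  refine ⟨c * l, W, hW, fun v hv' => ?_⟩
  have key : H (c • ω) v - (c * l) • v = c • (H ω v - l • v) := by
    rw [hH c hc, LinearMap.smul_apply, smul_sub, smul_smul]
  rw [key, norm_smul, Real.norm_eq_abs, abs_of_pos hc, mul_assoc]
  exact mul_le_mul_of_nonneg_left (hv v hv') hc.le

omit [FiniteDimensional ℝ E] [MeasurableSpace E] in
/-- [cite: ImbrieJSP2016, eq. (1.1)] SCALING RULE for the variational small-gap sets of a
positively homogeneous family: `c • smallGap H ε = smallGap H (c ε)` for `c > 0`. -/
theorem smallGap_scaling {H : E → V →ₗ[ℝ] V}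
    (hH : ∀ c : ℝ, 0 < c → ∀ ω : E, H (c • ω) = c • H ω) {c : ℝ} (hc : 0 < c) (ε : ℝ) :
    c • smallGap H ε = smallGap H (c * ε) := by
  ext ω'
  rw [Set.mem_smul_set]
  constructor
  · rintro ⟨ω, hω, rfl⟩
    exact smul_mem_smallGap hH hc hω
  · intro hω'
    have h1 : c⁻¹ • ω' ∈ smallGap H (c⁻¹ * (c * ε)) := smul_mem_smallGap hH (inv_pos.mpr hc) hω'
    rw [← mul_assoc, inv_mul_cancel₀ hc.ne', one_mul] at h1
    exact ⟨c⁻¹ • ω', h1, by rw [smul_smul, mul_inv_cancel₀ hc.ne', one_smul]⟩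

omit [FiniteDimensional ℝ E] [MeasurableSpace E] in
/-- [cite: ImbrieJSP2016, eq. (1.1)] A polyhedral cone `{ω | ∀ i, 0 ≤ fᵢ ω}` (`fᵢ` linear; in the
model: the constraints `tᵢ ≥ 0`) is invariant under positive dilations. -/
theorem smul_cone_eq {ι : Type*} (f : ι → E →ₗ[ℝ] ℝ) {c : ℝ} (hc : 0 < c) :
    c • {ω : E | ∀ i, 0 ≤ f i ω} = {ω : E | ∀ i, 0 ≤ f i ω} := by
  ext ω'
  rw [Set.mem_smul_set]
  constructor
  · rintro ⟨ω, hω, rfl⟩ i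
    rw [Set.mem_setOf_eq] at hω
    rw [LinearMap.map_smul, smul_eq_mul]
    exact mul_nonneg hc.le (hω i)
  · intro hω'
    refine ⟨c⁻¹ • ω', fun i => ?_, by rw [smul_smul, mul_inv_cancel₀ hc.ne', one_smul]⟩
    rw [LinearMap.map_smul, smul_eq_mul]
    exact mul_nonneg (inv_pos.mpr hc).le (hω' i)

omit [FiniteDimensional ℝ E] [MeasurableSpace E] in
/-- [cite: ImbrieJSP2016, eq. (1.1)] Restricting a scaling family of sets to a dilation-invariant
cone preserves the scaling rule. -/
theorem coneRestrict_scaling (A : ℝ → Set E) (K : Set E)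
    (hA : ∀ c ε : ℝ, 0 < c → c • A ε = A (c * ε)) (hK : ∀ c : ℝ, 0 < c → c • K = K) :
    ∀ c ε : ℝ, 0 < c → c • (A ε ∩ K) = A (c * ε) ∩ K := by
  intro c ε hc
  rw [smul_set_inter₀ hc.ne', hA c ε hc, hK c hc]

/-- [cite: ImbrieJSP2016, eq. (1.1), assumption LLA(ν, C)] GLOBALISATION FOR THE SMALL-GAP SETS
OF A POSITIVELY HOMOGENEOUS FAMILY ON A CONE (LLA.md (Q7.1) + (Q7.2), kernel-checked form).  In
dimension `≥ 2`: if every point of the unit sphere of the parameter space has a neighbourhood on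
which the cone-restricted variational small-gap sets obey a local linear law, then they obey ONE
linear law with a finite constant on the punctured unit ball. -/
theorem ball_law_smallGap [BorelSpace E] [Nontrivial E] (μ : Measure E) [μ.IsAddHaarMeasure]
    (hd : 2 ≤ Module.finrank ℝ E) (H : E → V →ₗ[ℝ] V)
    (hH : ∀ c : ℝ, 0 < c → ∀ ω : E, H (c • ω) = c • H ω) {ι : Type*} (f : ι → E →ₗ[ℝ] ℝ)
    (hsph : ∀ y : E, ‖y‖ = 1 → ∃ U ∈ 𝓝 y, ∃ C : ℝ≥0∞, C ≠ ⊤ ∧ ∀ ε : ℝ, 0 < ε →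
      μ ((smallGap H ε ∩ {ω : E | ∀ i, 0 ≤ f i ω}) ∩ U) ≤ C * ENNReal.ofReal ε) :
    ∃ C' : ℝ≥0∞, C' ≠ ⊤ ∧ ∀ ε : ℝ, 0 < ε →
      μ ((smallGap H ε ∩ {ω : E | ∀ i, 0 ≤ f i ω}) ∩ {x : E | 0 < ‖x‖ ∧ ‖x‖ ≤ 1})
        ≤ C' * ENNReal.ofReal ε :=
  ball_law_of_sphere_laws μ hd (fun ε => smallGap H ε ∩ {ω : E | ∀ i, 0 ≤ f i ω})
    (coneRestrict_scaling (fun ε => smallGap H ε) _ (fun _ ε hc => smallGap_scaling hH hc ε)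
      (fun _ hc => smul_cone_eq f hc)) hsph

/-- [cite: ImbrieJSP2016, eq. (1.1), assumption LLA(ν, C)] GLOBALISATION FOR THE SUBLEVEL SETS
OF A POSITIVELY HOMOGENEOUS GAP FUNCTION ON A CONE (the form closest to LLA.md (Q7.1)–(Q7.2): take
`g ω` = the minimal adjacent eigenvalue gap of the linear family `H ω`, which is positively
homogeneous of degree one, and the cone `t ≥ 0`).  Local linear laws for `{g < ε} ∩ cone` near
every point of the unit sphere ⟹ one linear law with a finite constant on the punctured unit ball. -/
theorem ball_law_gapFun [BorelSpace E] [Nontrivial E] (μ : Measure E) [μ.IsAddHaarMeasure]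
    (hd : 2 ≤ Module.finrank ℝ E) (g : E → ℝ)
    (hg : ∀ (c : ℝ) (x : E), 0 < c → g (c • x) = c * g x) {ι : Type*} (f : ι → E →ₗ[ℝ] ℝ)
    (hsph : ∀ y : E, ‖y‖ = 1 → ∃ U ∈ 𝓝 y, ∃ C : ℝ≥0∞, C ≠ ⊤ ∧ ∀ ε : ℝ, 0 < ε →
      μ (({x : E | g x < ε} ∩ {ω : E | ∀ i, 0 ≤ f i ω}) ∩ U) ≤ C * ENNReal.ofReal ε) :
    ∃ C' : ℝ≥0∞, C' ≠ ⊤ ∧ ∀ ε : ℝ, 0 < ε →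
      μ (({x : E | g x < ε} ∩ {ω : E | ∀ i, 0 ≤ f i ω}) ∩ {x : E | 0 < ‖x‖ ∧ ‖x‖ ≤ 1})
        ≤ C' * ENNReal.ofReal ε :=
  ball_law_of_sphere_laws μ hd (fun ε => {x : E | g x < ε} ∩ {ω : E | ∀ i, 0 ≤ f i ω})
    (coneRestrict_scaling (fun ε => {x : E | g x < ε}) _
      (fun c ε hc => DyadicHomogeneity.gapSet_scaling g hg c ε hc)
      (fun _ hc => smul_cone_eq f hc)) hsph

end SmallGap

end Literature.MathematicalPhysics.QuantumLattice.Imbrie2016.LocalLawCompactness
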